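import Summits.HodgeConjecture.HodgeConjecture.Theses.LinearSystemTorelli
import Literature.AlgebraicGeometry.HodgeTheory.ClassesSupportedOn
import Literature.AlgebraicGeometry.HodgeTheory.HodgeClassesCupPairing
import Literature.AlgebraicGeometry.HodgeTheory.SupportedClassesHodgeConiveau
import Summits.HodgeConjecture.HodgeConjecture.Theorems.LinearSystemTorelliMiddleDivisorSupportFourfoldPairingSplit
import Literature.AlgebraicGeometry.HodgeTheory.SupportedHodgeClassesAlgebraic
import Literature.AlgebraicGeometry.HodgeTheory.GysinKernelProofs
import Literature.AlgebraicGeometry.HodgeTheory.HodgeTypePullback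
import Literature.AlgebraicGeometry.HodgeTheory.ComplexConjugationHolds
import Literature.AlgebraicGeometry.Resolution.ProjectiveResolutionProofs
import Literature.AlgebraicGeometry.Motives.ComplexPointsOrientation
import Summits.HodgeConjecture.HodgeConjecture.Theorems.EndoscopicMiddleDegreeIsotypicMiddleClassesAlgebraicStubTopGysinInjective
import Summits.HodgeConjecture.HodgeConjecture.Theorems.LinearSystemTorelliDivisorInduction

/-! (INLINED COPY — tree version: `Summits/HodgeConjecture/HodgeConjecture/Theorems/LinearSystemTorelliMiddleDivisorSupportFourfoldThreefoldDetection.lean`, p105436 ACCEPTED 2026-08-16; inlined here under namespace `…DefectSheaf.Inlined` only because the farm snapshot serving crux workfiles had not yet built that module; replace by the import when it has.)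

# Route `LinearSystemTorelli` — crux `MiddleDivisorSupportFourfold` (stmt-HodgeConjecture-2409), line `Sketch`: stub `ThreefoldDetection`

Helper file for the crux item stmt-HodgeConjecture-2409 (route `LinearSystemTorelli`), serving the
registered stub `stub_threefoldDetection : ThreefoldDetection` of the line skeleton
`Cruxes/MiddleDivisorSupportFourfold/Lines/Sketch.lean` — de Cataldo–Migliorini, *On singularities
of primitive cohomology classes* (PAMS 137 (2009) = arXiv:0711.1307), §4, last paragraph, with
`n = 2`: on a smooth projective complex fourfold `X`, a rational `(2,2)`-class `c ∈ H⁴(X(ℂ); ℂ)`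
that pairs non-trivially (cup product into `H⁸(X(ℂ); ℂ)`) with a class supported on a divisor
`Z ⊊ X` (`a ∈ classesSupportedOn X Z 4 = ker (H⁴(X(ℂ)) → H⁴((X ∖ Z)(ℂ)))`) pairs non-trivially with
an algebraic surface class (`∈ supportedClasses X 4 2 = Alg²(X)`).

What is PROVED here (no `sorry`, no new definition, no new named fact):

* `threefoldDetection_map_eq_zero_of_forall_cupProduct_eq_zero` — the THREEFOLD STEP: if `c` is
  cup-orthogonal to `Alg²(X)`, then `g^* c = 0` for every morphism `g : Y ⟶ X` from a smooth
  projective threefold `Y`; conditional on BFNP (6.1) for threefolds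
  (`hodgeClasses_cupPairing_nondegenerate 3 Y`) and Lefschetz `(1,1)` (`lefschetzOneOne_rational`).
* `threefoldDetection_cupProduct_complexGysin_eq_zero` — hence `c ∪ g_* y = 0` for every Gysin
  summand `g_* y`, `g : Y ⟶ X` from a smooth projective `Y` of dimension `≤ 3` (threefolds by the
  projection formula and the threefold step; surfaces because `g_*(H⁰(Y(ℂ))) ⊆ Alg²(X)`; curves and
  points contribute nothing to `H⁴`).
* `linearSystemTorelli_middleDivisorSupportFourfold_threefoldDetection_of` — the stub's unfolded
  statement VERBATIM, conditional on THREE named facts of the tree taken by name: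
  `Deligne1974_ker_restrictCompl_eq_iSup_range_complexGysin` (Deligne, Hodge III, Cor. 8.2.8:
  `ker (H⁴(X) → H⁴(X ∖ Z)) = Σⱼ im (gⱼ)_*` for a desingularisation `⊔ Yⱼ → Z` of the components),
  `∀ Y, hodgeClasses_cupPairing_nondegenerate 3 Y` (Brosnan–Fang–Nie–Pearlstein (6.1) on smooth
  projective threefolds: a non-zero rational `(2,2)`-class has a rational `(1,1)` cup-partner) and
  `lefschetzOneOne_rational` (rational `(1,1)`-classes are divisor classes).

Proof (dCM §4, "the class … restricted to a general hyperplane section of a desingularisation of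
a component of the divisor is non-zero, hence pairs with an algebraic class by hard Lefschetz,
Lefschetz (1,1) and Hodge index"; here in the cohomological form forced by the tree's carriers).
Suppose `c ∪ a' = 0` for all `a' ∈ Alg²(X)`; we show `c ∪ a = 0` for every `a` supported on `Z`.
Desingularise the components of `Z` (`exists_family_iUnion_range_eq_of_isClosed`, fed with the
THEOREM `Resolution.Hironaka1964_projective_holds`): `Z = ⋃ⱼ gⱼ(Yⱼ)`, `Yⱼ` smooth projective of
dimension `mⱼ ≤ 3` (all points of `Z` have codimension `≥ 1`). By Deligne 8.2.8,
`a = Σⱼ (gⱼ)_* bⱼ` with `bⱼ ∈ H^{2mⱼ-4}(Yⱼ(ℂ); ℂ)` (Gysin morphisms `complexGysin μ` of the tree for an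
orientation family `μ`, which exists — `ComplexPoints.isOrientableOver` — and satisfies Poincaré
duality — `OrientationFamily.hasPoincareDuality`, a theorem). Surfaces (`mⱼ = 2`): `(gⱼ)_* bⱼ`,
`bⱼ ∈ H⁰ = N⁰H⁰`, lies in `N²H⁴(X) = Alg²(X)` (`complexGysin_mem_supportedClasses`, from the proved
support fact `gysinMap_restrictCompl_eq_zero_of_field ℂ`), so `c ∪ (gⱼ)_* bⱼ = 0`. Threefolds
(`mⱼ = 3`, `bⱼ ∈ H²`): by the projection formula (`complexGysin_cup`)
`c ∪ (gⱼ)_* bⱼ = (gⱼ)_* (gⱼ^* c ∪ bⱼ)`, and `gⱼ^* c = 0`: it is a rational (`IsRationalClass.pullback`)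
`(2,2)`-class (`IsOfHodgeType.map_of_le`, Hodge models exist: `nonempty_hodgeModel_holds`) on the
threefold `Yⱼ`; were it non-zero, (6.1) on `Yⱼ` would give a rational `(1,1)`-class `s` with
`gⱼ^* c ∪ s ≠ 0 ∈ H⁶(Yⱼ(ℂ))`; `s` is a divisor class (Lefschetz (1,1)), so `(gⱼ)_* s ∈ Alg²(X)` and
`0 = c ∪ (gⱼ)_* s = (gⱼ)_* (gⱼ^* c ∪ s)`, whence `gⱼ^* c ∪ s = 0` because the top-degree Gysin map
`H⁶(Yⱼ(ℂ)) → H⁸(X(ℂ))` is injective (`stub_topGysinInjective`, proved in the tree) — contradiction.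

Status of the three facts (2026-08-16): none has a `_holds`. Deligne 8.2.8 is reduced in the tree
to its homological core / to Prop. 8.2.7 for singular `Z` (`GysinKernelProofs`, `GysinKernelSplit`,
`GysinKernelWeights`: mixed Hodge theory); (6.1) to a hard Lefschetz datum with the Hodge–Riemann
anisotropy (`HodgeClassesCupPairingOfHodgeRiemann`); Lefschetz (1,1) to Serre's GAGA for line
bundles (`LefschetzOneOneOfGAGA`). Every other input is a theorem of the tree. Neither `Z ≠ X` nor
`c ≠ 0` is needed as an extra hypothesis (the codimension hypothesis bounds `dim Yⱼ ≤ 3`; the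
pairing hypothesis is only used through its negation).
-/

noncomputable section

namespace Summit.HodgeConjecture.HodgeConjecture.Cruxes.MiddleDivisorSupportFourfold.DefectSheaf.Inlined

open CategoryTheory
open Literature.AlgebraicGeometry Literature.AlgebraicGeometry.HodgeTheory
open Literature.AlgebraicGeometry.Motives
open Literature.AlgebraicTopology.SingularHomology

/-! ### The threefold step -/

/-- **The threefold step of de Cataldo–Migliorini §4 (`n = 2`).** Let `X` be a smooth projective
complex fourfold, `c ∈ H⁴(X(ℂ); ℂ)` a rational `(2,2)`-class which is cup-orthogonal to
`Alg²(X) = supportedClasses X 4 2`, and `g : Y ⟶ X` a morphism from a smooth projective threefold.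
Then `g^* c = 0` in `H⁴(Y(ℂ); ℂ)` — granted BFNP (6.1) on threefolds (`hP`) and Lefschetz `(1,1)`
(`hL`): `g^* c` is a rational `(2,2)`-class on `Y` (`IsRationalClass.pullback`,
`IsOfHodgeType.map_of_le` with a Hodge model of `Y`, `nonempty_hodgeModel_holds`); if it were
non-zero, (6.1) would give a rational `(1,1)`-class `s` on `Y` with `g^* c ∪ s ≠ 0 ∈ H⁶(Y(ℂ); ℂ)`;
but `s` is a divisor class (`hL`), so `g_* s ∈ Alg²(X)` (`complexGysin_mem_supportedClasses`, Gysin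
maps preserve supports) and `0 = c ∪ g_* s = g_* (g^* c ∪ s)` (projection formula
`complexGysin_cup`), whence `g^* c ∪ s = 0` by injectivity of the top-degree Gysin map
`H⁶(Y(ℂ)) → H⁸(X(ℂ))` (`stub_topGysinInjective`). The Gysin maps are those of any orientation
family (`ComplexPoints.isOrientableOver`; Poincaré duality `OrientationFamily.hasPoincareDuality`).
[cite: DecataldoMigliorini2009, §4] [cite: BrosnanFangNiePearlstein2009, §6 (6.1)]
[cite: FultonYoungTableaux1997, Appendix B §B.1 (6)] -/
theorem threefoldDetection_map_eq_zero_of_forall_cupProduct_eq_zero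
    (hP : ∀ Y : SchemeOver ℂ, hodgeClasses_cupPairing_nondegenerate 3 Y)
    (hL : lefschetzOneOne_rational) {Y X : SchemeOver ℂ}
    (hY : IsSmoothProjective 3 Y) (hX : IsSmoothProjective 4 X) (g : Y ⟶ X)
    {c : complexBetti X 4} (hc : IsRationalClass c) (hh : IsOfHodgeType 4 X 4 2 2 c)
    (hno : ∀ a ∈ supportedClasses X 4 2, cupProduct (rfl : (4:ℕ) + 4 = 4 + 4) c a = 0) :
    complexBetti.map g 4 c = 0 := by
  -- an orientation family, with Poincaré duality
  let μ : OrientationFamily := fun _ _ h ↦ (ComplexPoints.isOrientableOver ℂ h).some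
  have hμ : μ.HasPoincareDuality := μ.hasPoincareDuality
  -- `g^* c` is a rational `(2,2)`-class on the threefold `Y`
  have htQ : IsRationalClass (complexBetti.map g 4 c) := hc.pullback _
  have htH : IsOfHodgeType 3 Y 4 2 2 (complexBetti.map g 4 c) :=
    hh.map_of_le hY hX (nonempty_hodgeModel_holds.nonempty hY).some g (by norm_num)
  by_contra hne
  -- BFNP (6.1) on `Y` (`k = 2`, `l = 1`): a rational `(1,1)` partner `s`
  obtain ⟨s, hsQ, hsH, hts⟩ := hP Y hY 6 (show (2:ℕ) + 1 = 3 from rfl)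
    (show 2 * 2 + 2 * 1 = 6 by norm_num) _ htQ htH hne
  -- Lefschetz (1,1): `s` is a divisor class, so `g_* s ∈ Alg²(X)` is orthogonal to `c`
  have hsA : s ∈ algebraicClasses Y 1 := hL hY s hsQ hsH
  have hgs : complexGysin μ hY hX g (show 2 + 2 * 4 = 4 + 2 * 3 by norm_num) s ∈
      supportedClasses X 4 2 :=
    complexGysin_mem_supportedClasses (gysinMap_restrictCompl_eq_zero_of_field ℂ) μ hμ hY hX g _
      (r := 1) (s := 2) (by norm_num) hsA
  -- projection formula: `g_* (g^* c ∪ s) = c ∪ g_* s = 0`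
  have h1 : complexGysin μ hY hX g (show 6 + 2 * 4 = 4 + 4 + 2 * 3 by norm_num)
      (cupProduct (show 4 + 2 = 6 by norm_num) (complexBetti.map g 4 c) s) = 0 := by
    rw [complexGysin_cup hμ hY hX g (show 4 + 2 = 6 by norm_num)
      (show 6 + 2 * 4 = 4 + 4 + 2 * 3 by norm_num) (show 2 + 2 * 4 = 4 + 2 * 3 by norm_num)
      (rfl : (4:ℕ) + 4 = 4 + 4) c s]
    exact hno _ hgs
  -- the top-degree Gysin map `H⁶(Y(ℂ)) → H⁸(X(ℂ))` is injective
  exact hts (Summit.HodgeConjecture.HodgeConjecture.Theorems.stub_topGysinInjective μ hμ hY hX g (show 6 + 2 * 4 = 4 + 4 + 2 * 3 by norm_num) rfl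
    (h1.trans (map_zero _).symm))

/-! ### Every Gysin summand from a variety of dimension `≤ 3` is orthogonal to `c` -/

/-- **Gysin summands are cup-orthogonal to an `Alg²`-orthogonal rational `(2,2)`-class.** Let `X`
be a smooth projective complex fourfold, `c ∈ H⁴(X(ℂ); ℂ)` rational of type `(2,2)` and
cup-orthogonal to `Alg²(X)`, `g : Y ⟶ X` a morphism from a smooth projective `Y` of dimension
`m ≤ 3`, `μ` an orientation family and `y ∈ Hᵃ(Y(ℂ); ℂ)`, `a + 8 = 4 + 2m`. Then
`c ∪ g_* y = 0 ∈ H⁸(X(ℂ); ℂ)`. For `m = 3` (`a = 2`): `c ∪ g_* y = g_* (g^* c ∪ y)` (projection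
formula, `complexGysin_cup`) and `g^* c = 0`
(`threefoldDetection_map_eq_zero_of_forall_cupProduct_eq_zero`, facts `hP`, `hL`); for `m = 2`
(`a = 0`): `g_*(H⁰(Y(ℂ))) = g_*(N⁰H⁰) ⊆ N²H⁴(X) = Alg²(X)` (`complexGysin_mem_supportedClasses`, the
classes of the surfaces `g(Y)`), to which `c` is orthogonal; `m ≤ 1` does not occur.
[cite: DecataldoMigliorini2009, §4] [cite: FultonYoungTableaux1997, Appendix B §B.1 (6)] -/
theorem threefoldDetection_cupProduct_complexGysin_eq_zero
    (hP : ∀ Y : SchemeOver ℂ, hodgeClasses_cupPairing_nondegenerate 3 Y)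
    (hL : lefschetzOneOne_rational) (μ : OrientationFamily) {m : ℕ} {Y X : SchemeOver ℂ}
    (hY : IsSmoothProjective m Y) (hX : IsSmoothProjective 4 X) (g : Y ⟶ X) (hm : m + 1 ≤ 4)
    {a : ℕ} (hab : a + 2 * 4 = 4 + 2 * m)
    {c : complexBetti X 4} (hc : IsRationalClass c) (hh : IsOfHodgeType 4 X 4 2 2 c)
    (hno : ∀ a ∈ supportedClasses X 4 2, cupProduct (rfl : (4:ℕ) + 4 = 4 + 4) c a = 0)
    (y : complexBetti Y a) :
    cupProduct (rfl : (4:ℕ) + 4 = 4 + 4) c (complexGysin μ hY hX g hab y) = 0 := by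
  obtain rfl | rfl : m = 3 ∨ m = 2 := by omega
  · -- threefolds: projection formula and the threefold step
    obtain rfl : a = 2 := by omega
    rw [← complexGysin_cup μ.hasPoincareDuality hY hX g (show 4 + 2 = 6 by norm_num)
      (show 6 + 2 * 4 = 4 + 4 + 2 * 3 by norm_num) hab (rfl : (4:ℕ) + 4 = 4 + 4) c y,
      threefoldDetection_map_eq_zero_of_forall_cupProduct_eq_zero hP hL hY hX g hc hh hno,
      LinearMap.map_zero₂, map_zero]
  · -- surfaces: `g_* y ∈ Alg²(X)`
    obtain rfl : a = 0 := by omega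
    refine hno _ (complexGysin_mem_supportedClasses (gysinMap_restrictCompl_eq_zero_of_field ℂ) μ
      μ.hasPoincareDuality hY hX g hab (r := 0) (s := 2) (by norm_num) ?_)
    rw [supportedClasses_zero]
    exact Submodule.mem_top

/-! ### The stub, conditional on Deligne 8.2.8, BFNP (6.1) for threefolds and Lefschetz (1,1) -/

/-- **Stub `ThreefoldDetection` of line `Sketch` for the crux `MiddleDivisorSupportFourfold`
(stmt-HodgeConjecture-2409), conditional form** — de Cataldo–Migliorini arXiv:0711.1307 = PAMS 137
(2009), §4 (last paragraph, `n = 2`): on a smooth projective complex fourfold `X`, a rational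
`(2,2)`-class `c` pairing non-trivially with some class supported on a Zariski-closed `Z` all of
whose points have codimension `≥ 1` (`a ∈ classesSupportedOn X Z 4`, `c ∪ a ≠ 0 ∈ H⁸(X(ℂ); ℂ)`)
pairs non-trivially with some class of `Alg²(X) = supportedClasses X 4 2`. The body is VERBATIM
the skeleton's `ThreefoldDetection`; the hypotheses are the tree's named facts
`Deligne1974_ker_restrictCompl_eq_iSup_range_complexGysin` (Hodge III Cor. 8.2.8), BFNP (6.1) for
smooth projective threefolds (`hodgeClasses_cupPairing_nondegenerate 3 Y` for all `Y`) and
`lefschetzOneOne_rational`. Proof: contrapositively, if `c ⊥ Alg²(X)` then `c ∪ a = 0` for every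
`a` supported on `Z`: desingularise the components of `Z` (`exists_family_iUnion_range_eq_of_isClosed`
with the theorem `Resolution.Hironaka1964_projective_holds`; `dim Yⱼ ≤ 3`), write
`a = Σⱼ (gⱼ)_* bⱼ` (Deligne 8.2.8, for the orientation family of `ComplexPoints.isOrientableOver`,
Poincaré duality being `OrientationFamily.hasPoincareDuality`), and kill each summand with
`threefoldDetection_cupProduct_complexGysin_eq_zero`.
[cite: DecataldoMigliorini2009, §4] [cite: DeligneHodgeIII1974, Cor. 8.2.8]
[cite: BrosnanFangNiePearlstein2009, §6 (6.1)] [cite: VoisinHodgeI2002, Thm. 11.30] -/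
theorem linearSystemTorelli_middleDivisorSupportFourfold_threefoldDetection_of
    (hA : Deligne1974_ker_restrictCompl_eq_iSup_range_complexGysin)
    (hP : ∀ Y : Literature.AlgebraicGeometry.Motives.SchemeOver ℂ,
      hodgeClasses_cupPairing_nondegenerate 3 Y)
    (hL : lefschetzOneOne_rational) :
    ∀ ⦃X : Literature.AlgebraicGeometry.Motives.SchemeOver ℂ⦄,
      Literature.AlgebraicGeometry.Motives.IsSmoothProjective 4 X →
      ∀ (Z : Set X.left), IsClosed Z → (∀ z ∈ Z, (1 : ℕ∞) ≤ Order.coheight z) →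
        ∀ c : Literature.AlgebraicGeometry.HodgeTheory.complexBetti X 4,
          Literature.AlgebraicGeometry.HodgeTheory.IsRationalClass c →
          Literature.AlgebraicGeometry.HodgeTheory.IsOfHodgeType 4 X 4 2 2 c →
          (∃ a ∈ Literature.AlgebraicGeometry.HodgeTheory.classesSupportedOn X Z 4,
              Literature.AlgebraicTopology.SingularHomology.cupProduct (rfl : (4:ℕ) + 4 = 4 + 4) c a ≠ 0) →
          ∃ a ∈ Literature.AlgebraicGeometry.HodgeTheory.supportedClasses X 4 2,
            Literature.AlgebraicTopology.SingularHomology.cupProduct (rfl : (4:ℕ) + 4 = 4 + 4) c a ≠ 0 := by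
  intro X hX Z hZ hcod c hc hh hvis
  obtain ⟨a, ha, hca⟩ := hvis
  by_contra hno
  push Not at hno
  -- desingularise the components of `Z` (Hironaka): `Z = ⋃ j, g_j(Y j)`, `dim Y j ≤ 3`
  obtain ⟨ι, hι, m, Y, hY, g, hZg, hm⟩ :=
    exists_family_iUnion_range_eq_of_isClosed Resolution.Hironaka1964_projective_holds hX hZ
      (r := 1) hcod
  haveI := hι
  subst hZg
  -- an orientation family (Poincaré duality is a theorem of the tree)
  let μ : OrientationFamily := fun _ _ h ↦ (ComplexPoints.isOrientableOver ℂ h).some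
  -- Deligne 8.2.8: `a` is a sum of Gysin images from the `Y j`
  have ha' := Deligne1974_ker_restrictCompl_eq_iSup_range_complexGysin.mem_iSup_range hA μ
    μ.hasPoincareDuality hX hY g (mem_classesSupportedOn_iff.mp ha)
  -- every Gysin summand is cup-orthogonal to `c`
  have hle : (⨆ (j : ι) (a' : ℕ) (hab : a' + 2 * 4 = 4 + 2 * m j),
      LinearMap.range (complexGysin μ (hY j) hX (g j) hab)) ≤
        LinearMap.ker (cupProduct (rfl : (4:ℕ) + 4 = 4 + 4) c) := by
    refine iSup_le fun j ↦ iSup_le fun a' ↦ iSup_le fun hab ↦ ?_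
    rintro _ ⟨y, rfl⟩
    exact LinearMap.mem_ker.mpr (threefoldDetection_cupProduct_complexGysin_eq_zero hP hL μ (hY j)
      hX (g j) (hm j) hab hc hh hno y)
  exact hca (LinearMap.mem_ker.mp (hle ha'))

end Summit.HodgeConjecture.HodgeConjecture.Cruxes.MiddleDivisorSupportFourfold.DefectSheaf.Inlined

end

/-!
# Skeleton — line `Sketch` (card `gg-sheaf-cokernel`, ideator 1) for the crux
`LinearSystemTorelli.MiddleDivisorSupportFourfold` (stmt-HodgeConjecture-2409)

Lead-owned copy of `Lines/Sketch_ideator1.lean`, reshaped into stub form (sorries only in `stub_*`;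
`MiddleDivisorSupportFourfold_of` concludes the crux BY NAME). The de Cataldo–Migliorini visibility
reduction (arXiv:0711.1307 §4, n = 2) typed on the tree's carriers:

* `stub_visibleOnDivisors : VisibleOnDivisors` — THE BET (lead's stub): a non-zero rational
  `(2,2)`-class on a smooth projective fourfold, cup-orthogonal to `Alg² = supportedClasses X 4 2`,
  pairs non-trivially with some class supported on some divisor.
* `stub_threefoldDetection : ThreefoldDetection` — pairs with a divisor-supported class ⟹ pairs with
  an algebraic surface class (Deligne 8.2.8 + Hironaka + hard Lefschetz / Lefschetz (1,1) / Hodge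
  index on the resolved threefold components + Gysin algebraicity).
* `stub_pairingSplit : PairingSplit` — no non-zero Hodge class orthogonal to `Alg²` ⟹ `Hdg⁴ = Alg²`
  (dCM Fact 4.1 / BFNP (6.1) + finite-dimensionality + rational structure of `Alg²`).
* `stub_deligneGysinKernel`, `stub_cupPairingThreefold`, `stub_lefschetzOneOne` — the named-fact
  debts (Deligne 8.2.8; BFNP (6.1) on threefolds; Lefschetz (1,1)) modulo which the two reduction
  stubs are CLOSED by the landed helpers p103138 / p105436.
* `MiddleDivisorSupportFourfold_of` — the composition (`Alg² = N² ≤ N¹`), the ONLY theorem of the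
  file concluding the crux.
* `hc42_of_stubs`, `visibleOnDivisors_of_hc42` — size evidence: the lead's stub is HC(4,2).
* `hc42_of_crux`, `supported_of_hc42`, `crux_iff_hc42`, `visibleOnDivisors_iff_crux` (cycle 2) — the
  CIRCULARITY CERTIFICATE: modulo the named facts of the tree (Deligne 8.2.8, Voisin 2025 Cor. 2.12,
  BFNP (6.1) in dimensions 3 and 4, Lefschetz (1,1)) the lead's stub is EQUIVALENT to the crux.
-/

namespace Summit.HodgeConjecture.HodgeConjecture.Cruxes.MiddleDivisorSupportFourfold.DefectSheaf

open Literature.AlgebraicGeometry Literature.AlgebraicGeometry.HodgeTheory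
open Literature.AlgebraicTopology.SingularHomology

/-- Degree bookkeeping `H⁴ ∪ H⁴ → H⁸`. -/
theorem h44 : (4 : ℕ) + 4 = 4 + 4 := rfl

/-- THE BET. Every non-zero rational `(2,2)`-class `c` on a smooth projective fourfold that is
cup-orthogonal to all classes supported in codimension `2` (`supportedClasses X 4 2 =
algebraicClasses X 2`) is VISIBLE on some divisor: there is a Zariski-closed `Z ⊊ X` of
codimension `≥ 1` and a class `a` supported on `Z` (`a ∈ ker (H⁴(X) → H⁴(X ∖ Z))`) with
`c ∪ a ≠ 0`. (dCM 0711.1307 Prop. 3.7/Cor. 3.12: non-vanishing of the local Green–Griffiths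
invariant at some point of `|mL|`, `m ≫ 0`.) -/
def VisibleOnDivisors : Prop :=
  ∀ ⦃X : Motives.SchemeOver ℂ⦄, Motives.IsSmoothProjective 4 X →
    ∀ c : complexBetti X 4, IsRationalClass c → IsOfHodgeType 4 X 4 2 2 c → c ≠ 0 →
      (∀ a ∈ supportedClasses X 4 2, cupProduct h44 c a = 0) →
      ∃ (Z : Set X.left), IsClosed Z ∧ (∀ z ∈ Z, (1 : ℕ∞) ≤ Order.coheight z) ∧
        ∃ a ∈ classesSupportedOn X Z 4, cupProduct h44 c a ≠ 0

/-- THREEFOLD DETECTION (dCM §4, n = 2): if a rational `(2,2)`-class pairs non-trivially with a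
class supported on a divisor `Z`, it pairs non-trivially with a class supported in codimension `2`
(an algebraic surface class). -/
def ThreefoldDetection : Prop :=
  ∀ ⦃X : Motives.SchemeOver ℂ⦄, Motives.IsSmoothProjective 4 X →
    ∀ (Z : Set X.left), IsClosed Z → (∀ z ∈ Z, (1 : ℕ∞) ≤ Order.coheight z) →
      ∀ c : complexBetti X 4, IsRationalClass c → IsOfHodgeType 4 X 4 2 2 c →
        (∃ a ∈ classesSupportedOn X Z 4, cupProduct h44 c a ≠ 0) →
        ∃ a ∈ supportedClasses X 4 2, cupProduct h44 c a ≠ 0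

/-- PAIRING SPLIT (dCM Fact 4.1 / BFNP (6.1)): if every non-zero rational `(2,2)`-class pairs
non-trivially with some class supported in codimension `2`, then every rational `(2,2)`-class is
supported in codimension `2` (`Hdg⁴ = Alg²`). -/
def PairingSplit : Prop :=
  ∀ ⦃X : Motives.SchemeOver ℂ⦄, Motives.IsSmoothProjective 4 X →
    (∀ c : complexBetti X 4, IsRationalClass c → IsOfHodgeType 4 X 4 2 2 c → c ≠ 0 →
        ∃ a ∈ supportedClasses X 4 2, cupProduct h44 c a ≠ 0) →
    ∀ c : complexBetti X 4, IsRationalClass c → IsOfHodgeType 4 X 4 2 2 c →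
      c ∈ supportedClasses X 4 2

/-! ### Stubs (the only sorries of the skeleton)

After cycle 1 (2026-08-16): the two REDUCTION stubs are closed modulo named Literature facts
(landed helpers p103138, p105436); the sorries left are the lead's bet `stub_visibleOnDivisors`
(= HC(4,2), see `hc42_of_stubs` / `visibleOnDivisors_of_hc42` below) and three NAMED-FACT debts of
the tree (Deligne Hodge III 8.2.8; BFNP (6.1) on threefolds = hard Lefschetz + Hodge–Riemann;
Lefschetz (1,1), reduced in the tree to Serre GAGA for line bundles). -/

/-- STUB (lead): THE BET — visibility of non-zero `Alg²`-orthogonal rational `(2,2)`-classes on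
some divisor. With the two reduction stubs it gives HC(4,2) (`Hdg⁴ = Alg²`) for every smooth
projective fourfold; conversely HC(4,2) + BFNP (6.1) in dimension 4 give it back (vacuously): it IS
the Hodge conjecture for fourfolds in codimension two. -/
theorem stub_visibleOnDivisors : VisibleOnDivisors := by
  sorry

/-- STUB (named-fact debt): Deligne, Hodge III Cor. 8.2.8 — for `X` smooth projective and closed
immersions / maps `gⱼ : Yⱼ → X` from smooth projective `Yⱼ` covering a closed `Z`,
`ker (Hᵇ(X) → Hᵇ(X ∖ Z)) = Σⱼ im (gⱼ)_*` (Gysin images of a resolution). The tree's named fact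
`Literature.AlgebraicGeometry.HodgeTheory.Deligne1974_ker_restrictCompl_eq_iSup_range_complexGysin`
(HodgeTheory/GysinKernel.lean), undischarged (mixed Hodge theory: strictness / weights); used by
BOTH reduction stubs (for `PairingSplit` it yields `N²H⁴ ⊆ H^{2,2}` via
`Grothendieck1969_supportedClasses_le_hodgeConiveau_of_deligne`). -/
theorem stub_deligneGysinKernel : Deligne1974_ker_restrictCompl_eq_iSup_range_complexGysin := by
  sorry

/-- STUB (named-fact debt): BFNP 2009 §6 (6.1) on smooth projective THREEFOLDS — the cup product
is non-degenerate between rational `(2,2)`- and `(1,1)`-classes (hard Lefschetz `H² ≅ H⁴` over `ℚ`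
+ Hodge–Riemann / Hodge index). The tree's named fact
`Literature.AlgebraicGeometry.HodgeTheory.hodgeClasses_cupPairing_nondegenerate 3 Y`
(HodgeTheory/HodgeClassesCupPairing.lean; reduced to `hardLefschetz_hodgeRiemann 3 Y` in
HardLefschetzHodgeRiemann.lean), undischarged. -/
theorem stub_cupPairingThreefold :
    ∀ Y : Motives.SchemeOver ℂ, hodgeClasses_cupPairing_nondegenerate 3 Y := by
  sorry

/-- STUB (named-fact debt): Lefschetz `(1,1)` — rational `(1,1)`-classes are algebraic
(divisor classes). The tree's named fact `Literature.AlgebraicGeometry.HodgeTheory.lefschetzOneOne_rational`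
(HodgeTheory/LefschetzOneOne.lean), reduced in the tree to Serre GAGA for line bundles
(`lefschetzOneOne_rational_of_serreGAGA`, LefschetzOneOneOfGAGA.lean), undischarged. -/
theorem stub_lefschetzOneOne : lefschetzOneOne_rational := by
  sorry

/-- CLOSED modulo `stub_deligneGysinKernel`, `stub_cupPairingThreefold`, `stub_lefschetzOneOne`:
threefold detection (dCM §4, n = 2), by the landed helper
`linearSystemTorelli_middleDivisorSupportFourfold_threefoldDetection_of` (p105436: Deligne 8.2.8
writes a divisor-supported class as a sum of Gysin images from smooth projective `Yⱼ` of dimension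
`≤ 3`; projection formula; on a threefold a rational `(2,2)`-class with a non-zero cup product has
a rational `(1,1)` partner (6.1), algebraic by Lefschetz (1,1); Gysin preserves algebraicity and is
injective in top degree). -/
theorem stub_threefoldDetection : ThreefoldDetection :=
  Summit.HodgeConjecture.HodgeConjecture.Cruxes.MiddleDivisorSupportFourfold.DefectSheaf.Inlined.linearSystemTorelli_middleDivisorSupportFourfold_threefoldDetection_of
    stub_deligneGysinKernel stub_cupPairingThreefold stub_lefschetzOneOne

/-- CLOSED modulo `stub_deligneGysinKernel`: pairing split (dCM Fact 4.1), by the landed helper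
`linearSystemTorelli_middleDivisorSupportFourfold_pairingSplit_of_deligne` (p103138: ℚ-dimension
count `dim Hdg⁴ ≤ dim Alg²_ℚ` from the trivial left kernel, `H⁸(X(ℂ);ℂ) ≃ ℂ`, rational cup
products, `ℚ`-independence ⇒ `ℂ`-independence, and `N²H⁴ ⊆ H^{2,2}` from Deligne 8.2.8; BFNP (6.1)
in dimension 4 is NOT used). -/
theorem stub_pairingSplit : PairingSplit :=
  Summit.HodgeConjecture.HodgeConjecture.Theorems.linearSystemTorelli_middleDivisorSupportFourfold_pairingSplit_of_deligne
    stub_deligneGysinKernel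

/-- COMPOSITION — the crux BY NAME from the stubs (kernel-checked modulo the `sorry`s above):
visibility on divisors + threefold detection show that no non-zero rational `(2,2)`-class is
orthogonal to `Alg²`; pairing split gives `Hdg⁴ = Alg² = N² ≤ N¹`. -/
theorem MiddleDivisorSupportFourfold_of :
    Summit.HodgeConjecture.HodgeConjecture.Theses.LinearSystemTorelli.MiddleDivisorSupportFourfold := by
  intro X hX c hc hh
  have key : ∀ c : complexBetti X 4, IsRationalClass c → IsOfHodgeType 4 X 4 2 2 c → c ≠ 0 →
      ∃ a ∈ supportedClasses X 4 2, cupProduct h44 c a ≠ 0 := by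
    intro c hc hh hne
    by_contra hno
    push Not at hno
    obtain ⟨Z, hZ, hcod, hvis⟩ := stub_visibleOnDivisors hX c hc hh hne hno
    obtain ⟨a, ha, hne'⟩ := stub_threefoldDetection hX Z hZ hcod c hc hh hvis
    exact hne' (hno a ha)
  exact supportedClasses_mono X 4 (by norm_num : 1 ≤ 2) (stub_pairingSplit hX key c hc hh)

/-! ### Size of the lead's stub (evidence, no sorry of its own)

`VisibleOnDivisors` is the Hodge conjecture for fourfolds in codimension two: the three line
statements prove `HC42` (below), and `HC42` + BFNP (6.1) in dimension 4 give `VisibleOnDivisors`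
back vacuously. -/

/-- The Hodge conjecture for smooth projective complex fourfolds in codimension `2`, cycle part:
every rational `(2,2)`-class lies in `algebraicClasses X 2 = supportedClasses X 4 2 = N²H⁴`. -/
def HC42 : Prop :=
  ∀ ⦃X : Motives.SchemeOver ℂ⦄, Motives.IsSmoothProjective 4 X →
    ∀ c : complexBetti X 4, IsRationalClass c → IsOfHodgeType 4 X 4 2 2 c →
      c ∈ algebraicClasses X 2

/-- The three line statements prove HC(4,2) itself (hypothetical form: no stub is consumed). -/
theorem hc42_of_stubs (hV : VisibleOnDivisors) (hT : ThreefoldDetection) (hP : PairingSplit) :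
    HC42 := by
  intro X hX c hc hh
  have key : ∀ c : complexBetti X 4, IsRationalClass c → IsOfHodgeType 4 X 4 2 2 c → c ≠ 0 →
      ∃ a ∈ supportedClasses X 4 2, cupProduct h44 c a ≠ 0 := by
    intro c hc hh hne
    by_contra hno
    push Not at hno
    obtain ⟨Z, hZ, hcod, hvis⟩ := hV hX c hc hh hne hno
    obtain ⟨a, ha, hne'⟩ := hT hX Z hZ hcod c hc hh hvis
    exact hne' (hno a ha)
  exact hP hX key c hc hh

/-- Conversely HC(4,2) and BFNP (6.1) in dimension 4 (`hodgeClasses_cupPairing_nondegenerate 4 X`)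
give `VisibleOnDivisors` VACUOUSLY: a non-zero rational `(2,2)`-class has a rational `(2,2)`
cup-partner, algebraic by HC(4,2), so no such class is orthogonal to `supportedClasses X 4 2`. -/
theorem visibleOnDivisors_of_hc42
    (hHR : ∀ X : Motives.SchemeOver ℂ, hodgeClasses_cupPairing_nondegenerate 4 X) (h : HC42) :
    VisibleOnDivisors := by
  intro X hX c hc hh hne horth
  exfalso
  obtain ⟨a, ha, haH, hca⟩ := (hHR X).middle (n := 2) hX c hc hh hne
  exact hca (horth a (h hX a ha haH))

/-! ### Circularity certificate (cycle 2, continuation lead; no sorry of its own)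

Modulo named facts of the Literature library ONLY — Deligne Hodge III Cor. 8.2.8 (`hD`), Voisin 2025
Cor. 2.12 (`hB`, semisimplicity lift of Hodge classes along Gysin maps; these two give the route item
`DivisorInduction` by the landed `linearSystemTorelli_divisorInduction_of_deligne_of_hodgeClassLift`),
Lefschetz `(1,1)` (`hL`), and BFNP (6.1) on threefolds (`hP3`) and on fourfolds (`hP4`) — the lead's
stub `VisibleOnDivisors` is EQUIVALENT to the crux `MiddleDivisorSupportFourfold`, and both are
equivalent to HC(4,2). So the line `Sketch` does not shrink the crux: its bet restates it (COSTUME). -/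

/-- HC(3,1) — rational `(1,1)`-classes on smooth projective threefolds are algebraic — is the
`n = 3` instance of Lefschetz `(1,1)`, in the binder shape `DivisorInduction 3 2` consumes. -/
theorem hc31_of_lefschetzOneOne (hL : lefschetzOneOne_rational) :
    ∀ ⦃Y : Motives.SchemeOver ℂ⦄, Motives.IsSmoothProjective 3 Y →
      ∀ c : complexBetti Y (2 * (2 - 1)), IsRationalClass c →
        IsOfHodgeType 3 Y (2 * (2 - 1)) (2 - 1) (2 - 1) c → c ∈ algebraicClasses Y (2 - 1) :=
  fun _Y hY c hc hh => hL hY c hc hh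

/-- crux ⟹ HC(4,2), modulo the route item `DivisorInduction` (at `(n, p) = (3, 2)`) and Lefschetz
`(1,1)`: a rational `(2,2)`-class is divisor-supported by the crux, hence algebraic by divisor
induction from HC(3,1). (The logic of the route's former support `FunnelFourfold`.) -/
theorem hc42_of_crux_of_divisorInduction
    (hDI : Summit.HodgeConjecture.HodgeConjecture.Theses.LinearSystemTorelli.DivisorInduction)
    (hL : lefschetzOneOne_rational)
    (h : Summit.HodgeConjecture.HodgeConjecture.Theses.LinearSystemTorelli.MiddleDivisorSupportFourfold) :
    HC42 := by
  intro X hX c hc hh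
  exact hDI 3 2 (by norm_num) (hc31_of_lefschetzOneOne hL) hX c hc hh (h hX c hc hh)

/-- crux ⟹ HC(4,2), modulo NAMED LITERATURE FACTS only: Deligne 8.2.8 (`hD`) and Voisin 2025
Cor. 2.12 (`hB`) give `DivisorInduction` (landed
`Theorems.linearSystemTorelli_divisorInduction_of_deligne_of_hodgeClassLift`), and Lefschetz `(1,1)`. -/
theorem hc42_of_crux (hD : Deligne1974_ker_restrictCompl_eq_iSup_range_complexGysin)
    (hB : Voisin2025_hodgeClass_lift_complexGysin) (hL : lefschetzOneOne_rational)
    (h : Summit.HodgeConjecture.HodgeConjecture.Theses.LinearSystemTorelli.MiddleDivisorSupportFourfold) :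
    HC42 :=
  hc42_of_crux_of_divisorInduction
    (Summit.HodgeConjecture.HodgeConjecture.Theorems.linearSystemTorelli_divisorInduction_of_deligne_of_hodgeClassLift
      hD hB) hL h

/-- HC(4,2) ⟹ divisor support of rational `(2,2)`-classes (the crux's body), unconditionally:
`Alg² = N²H⁴ ≤ N¹H⁴` (`supportedClasses_mono`). Stated on the unfolded body so that the skeleton has
a single theorem concluding the crux by name (`MiddleDivisorSupportFourfold_of`). -/
theorem supported_of_hc42 (h : HC42) :
    ∀ ⦃X : Motives.SchemeOver ℂ⦄, Motives.IsSmoothProjective 4 X →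
      ∀ c : complexBetti X 4, IsRationalClass c → IsOfHodgeType 4 X 4 2 2 c →
        c ∈ supportedClasses X 4 1 :=
  fun X hX c hc hh => supportedClasses_mono X 4 (by norm_num : 1 ≤ 2) (h hX c hc hh)

/-- crux ⟺ HC(4,2) modulo Deligne 8.2.8, Voisin 2025 Cor. 2.12 and Lefschetz `(1,1)` (the
converse direction is unconditional, `supported_of_hc42`). -/
theorem crux_iff_hc42 (hD : Deligne1974_ker_restrictCompl_eq_iSup_range_complexGysin)
    (hB : Voisin2025_hodgeClass_lift_complexGysin) (hL : lefschetzOneOne_rational) :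
    Summit.HodgeConjecture.HodgeConjecture.Theses.LinearSystemTorelli.MiddleDivisorSupportFourfold ↔
      HC42 :=
  ⟨hc42_of_crux hD hB hL, fun h => supported_of_hc42 h⟩

/-- The two reduction statements of the line hold modulo the named facts (landed helpers p105436,
p103138), so `VisibleOnDivisors ⟹ HC(4,2)` modulo Deligne 8.2.8, (6.1) on threefolds and Lefschetz
`(1,1)` — no stub is consumed. -/
theorem hc42_of_visibleOnDivisors (hD : Deligne1974_ker_restrictCompl_eq_iSup_range_complexGysin)
    (hP3 : ∀ Y : Motives.SchemeOver ℂ, hodgeClasses_cupPairing_nondegenerate 3 Y)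
    (hL : lefschetzOneOne_rational) (hV : VisibleOnDivisors) : HC42 :=
  hc42_of_stubs hV
    (Summit.HodgeConjecture.HodgeConjecture.Cruxes.MiddleDivisorSupportFourfold.DefectSheaf.Inlined.linearSystemTorelli_middleDivisorSupportFourfold_threefoldDetection_of
      hD hP3 hL)
    (Summit.HodgeConjecture.HodgeConjecture.Theorems.linearSystemTorelli_middleDivisorSupportFourfold_pairingSplit_of_deligne
      hD)

/-- **CIRCULARITY CERTIFICATE.** Modulo the named Literature facts Deligne 8.2.8 (`hD`), Voisin 2025
Cor. 2.12 (`hB`), BFNP (6.1) on threefolds (`hP3`) and fourfolds (`hP4`) and Lefschetz `(1,1)` (`hL`)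
— all theorems in print, none a stub of mathematical content of this line — the lead's stub
`VisibleOnDivisors` is EQUIVALENT to the crux. The line `Sketch` therefore reduces the crux to
itself: its bet is a costume of `MiddleDivisorSupportFourfold` (= HC for fourfolds in codimension 2). -/
theorem visibleOnDivisors_iff_crux (hD : Deligne1974_ker_restrictCompl_eq_iSup_range_complexGysin)
    (hB : Voisin2025_hodgeClass_lift_complexGysin)
    (hP3 : ∀ Y : Motives.SchemeOver ℂ, hodgeClasses_cupPairing_nondegenerate 3 Y)
    (hP4 : ∀ X : Motives.SchemeOver ℂ, hodgeClasses_cupPairing_nondegenerate 4 X)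
    (hL : lefschetzOneOne_rational) :
    VisibleOnDivisors ↔
      Summit.HodgeConjecture.HodgeConjecture.Theses.LinearSystemTorelli.MiddleDivisorSupportFourfold :=
  ⟨fun hV => (crux_iff_hc42 hD hB hL).2 (hc42_of_visibleOnDivisors hD hP3 hL hV),
    fun h => visibleOnDivisors_of_hc42 hP4 (hc42_of_crux hD hB hL h)⟩

end Summit.HodgeConjecture.HodgeConjecture.Cruxes.MiddleDivisorSupportFourfold.DefectSheaf
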